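import Mathlib.MeasureTheory.Integral.IntervalIntegral.TrapezoidalRule

/-!
# KL-MARGIN-SCAN reader (22) «kernel-lindhard-enclosure» — the 2-D CORNER-MEAN lemma (iterated trapezoidal rule on a rectangle)

Generic real-analysis brick for the two remaining «square-cell» rules of the instrument (`CeilChordSoundOrd` — chord ceiling — and
`FloorInsideSoundAt` — Jensen floor; see `HOME/p1/g25/CORNER-MEAN-DESIGN.md`): both compare the CELL AVERAGE of the band difference `g` with the
MEAN OF ITS FOUR CORNER VALUES through the kernel's slack `interpE = (8/3)·D·(1+2|t′|)·h²`, which is exactly the bound below with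
`‖∂ₓₓg‖, ‖∂ᵧᵧg‖ ≤ 4(1+2|t′|)`.  Proved here, for an iterated interval integral over `[x0,x1] × [y0,y1]`:
`|∫∫ f − (x1−x0)(y1−y0)·(corner mean)| ≤ (x1−x0)(y1−y0)·((y1−y0)²ζy + (x1−x0)²ζx)/12`, from Mathlib's one-dimensional
`trapezoidal_error_le_of_c2` applied on every vertical slice and on the two horizontal edges (the constant `1/12` of the AVERAGED trapezoid
error — the pointwise bilinear-interpolation constant `1/8` would not justify the kernel's `interpE`).  Honest framing: elementary analysis;
nothing in this file asserts a KL margin at any `t′ ≠ 0`, `K₃`, `U₀`, the window or B1g dominance; a Kohn–Luttinger instability statement is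
not ODLRO and nothing here proves superconductivity in the Hubbard model.  (p1 g25, 2026-08-29.)
-/

noncomputable section

set_option linter.dupNamespace false

namespace Summit.HubbardSuperconductivity.HubbardSuperconductivity.Theorems.KlLindhardEnclosure

open Real Set MeasureTheory intervalIntegral

/-- One trapezoid: `|(b − a)/2·(g a + g b) − ∫ₐᵇ g| ≤ |b − a|³ ζ / 12` for `g ∈ C²(uIcc a b)` with `|g''| ≤ ζ` (Mathlib's
`trapezoidal_error_le_of_c2` at `N = 1`). -/
theorem trapezoid_one_error_le {g : ℝ → ℝ} {a b ζ : ℝ} (hg : ContDiffOn ℝ 2 g (uIcc a b))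
    (hζ : ∀ t, |iteratedDerivWithin 2 g (uIcc a b) t| ≤ ζ) :
    |(b - a) / 2 * (g a + g b) - ∫ t in a..b, g t| ≤ |b - a| ^ 3 * ζ / 12 := by
  have h := trapezoidal_error_le_of_c2 hg hζ (N := 1) one_pos
  simpa [trapezoidal_error, trapezoidal_integral_one] using h

/-- **THE 2-D CORNER-MEAN LEMMA** (iterated trapezoidal rule on a rectangle, `x0 ≤ x1`, `y0 ≤ y1`): if every vertical slice `f x ·` is
`C²` on `(uIcc y0 y1)` with second derivative bounded by `ζy`, the two horizontal edges `f · y0`, `f · y1` are `C²` on `(uIcc x0 x1)` with second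
derivative bounded by `ζx`, and the slice integral and the two edges are interval-integrable in `x`, then
`|∫_{x0}^{x1} ∫_{y0}^{y1} f − (x1−x0)(y1−y0)·(f x0 y0 + f x0 y1 + f x1 y0 + f x1 y1)/4| ≤ (x1−x0)(y1−y0)·((y1−y0)²ζy + (x1−x0)²ζx)/12`. -/
theorem corner_mean_error_le {f : ℝ → ℝ → ℝ} {x0 x1 y0 y1 ζx ζy : ℝ} (hx : x0 ≤ x1) (hy : y0 ≤ y1)
    (hcy : ∀ x, ContDiffOn ℝ 2 (f x) (uIcc y0 y1)) (hζy : ∀ x t, |iteratedDerivWithin 2 (f x) (uIcc y0 y1) t| ≤ ζy)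
    (hcx0 : ContDiffOn ℝ 2 (fun x => f x y0) (uIcc x0 x1)) (hζx0 : ∀ t, |iteratedDerivWithin 2 (fun x => f x y0) (uIcc x0 x1) t| ≤ ζx)
    (hcx1 : ContDiffOn ℝ 2 (fun x => f x y1) (uIcc x0 x1)) (hζx1 : ∀ t, |iteratedDerivWithin 2 (fun x => f x y1) (uIcc x0 x1) t| ≤ ζx)
    (hint : IntervalIntegrable (fun x => ∫ y in y0..y1, f x y) volume x0 x1)
    (hint0 : IntervalIntegrable (fun x => f x y0) volume x0 x1) (hint1 : IntervalIntegrable (fun x => f x y1) volume x0 x1) :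
    |(∫ x in x0..x1, ∫ y in y0..y1, f x y) - (x1 - x0) * (y1 - y0) * (f x0 y0 + f x0 y1 + f x1 y0 + f x1 y1) / 4|
      ≤ (x1 - x0) * (y1 - y0) * ((y1 - y0) ^ 2 * ζy + (x1 - x0) ^ 2 * ζx) / 12 := by
  -- slice errors and edge errors
  have hA : ∀ x, |(y1 - y0) / 2 * (f x y0 + f x y1) - ∫ y in y0..y1, f x y| ≤ |y1 - y0| ^ 3 * ζy / 12 :=
    fun x => trapezoid_one_error_le (hcy x) (hζy x)
  have hB0 : |(x1 - x0) / 2 * (f x0 y0 + f x1 y0) - ∫ x in x0..x1, f x y0| ≤ |x1 - x0| ^ 3 * ζx / 12 :=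
    trapezoid_one_error_le (g := fun x => f x y0) hcx0 hζx0
  have hB1 : |(x1 - x0) / 2 * (f x0 y1 + f x1 y1) - ∫ x in x0..x1, f x y1| ≤ |x1 - x0| ^ 3 * ζx / 12 :=
    trapezoid_one_error_le (g := fun x => f x y1) hcx1 hζx1
  -- the slice error as a function of x, and its integral
  set e : ℝ → ℝ := fun x => (y1 - y0) / 2 * (f x y0 + f x y1) - ∫ y in y0..y1, f x y with he
  have hg : IntervalIntegrable (fun x => (y1 - y0) / 2 * (f x y0 + f x y1)) volume x0 x1 :=
    (hint0.add hint1).const_mul _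
  have heint : IntervalIntegrable e volume x0 x1 := hg.sub hint
  have hI : (∫ x in x0..x1, ∫ y in y0..y1, f x y) = (∫ x in x0..x1, (y1 - y0) / 2 * (f x y0 + f x y1)) - ∫ x in x0..x1, e x := by
    rw [← intervalIntegral.integral_sub hg heint]
    congr 1; ext x; simp [he]
  have hG : (∫ x in x0..x1, (y1 - y0) / 2 * (f x y0 + f x y1))
      = (y1 - y0) / 2 * ((∫ x in x0..x1, f x y0) + ∫ x in x0..x1, f x y1) := by
    rw [intervalIntegral.integral_const_mul, intervalIntegral.integral_add hint0 hint1]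
  have hE : |∫ x in x0..x1, e x| ≤ |y1 - y0| ^ 3 * ζy / 12 * |x1 - x0| := by
    have := intervalIntegral.norm_integral_le_of_norm_le_const (a := x0) (b := x1) (f := e) (C := |y1 - y0| ^ 3 * ζy / 12)
      (fun x _ => by rw [Real.norm_eq_abs]; exact hA x)
    simpa [Real.norm_eq_abs] using this
  -- algebra: I − area·C = −(y1−y0)/2·(e0 + e1) − ∫ e
  set e0 := (x1 - x0) / 2 * (f x0 y0 + f x1 y0) - ∫ x in x0..x1, f x y0 with he0
  set e1 := (x1 - x0) / 2 * (f x0 y1 + f x1 y1) - ∫ x in x0..x1, f x y1 with he1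
  set E := ∫ x in x0..x1, e x with hEdef
  have hid : (∫ x in x0..x1, ∫ y in y0..y1, f x y) - (x1 - x0) * (y1 - y0) * (f x0 y0 + f x0 y1 + f x1 y0 + f x1 y1) / 4
      = -((y1 - y0) / 2) * (e0 + e1) - E := by
    rw [hI, hG, he0, he1]; ring
  rw [hid]
  have hx' : |x1 - x0| = x1 - x0 := abs_of_nonneg (by linarith)
  have hy' : |y1 - y0| = y1 - y0 := abs_of_nonneg (by linarith)
  rw [hx'] at hB0 hB1 hE
  rw [hy'] at hE
  have h1 : |-((y1 - y0) / 2) * (e0 + e1)| ≤ (y1 - y0) / 2 * ((x1 - x0) ^ 3 * ζx / 12 + (x1 - x0) ^ 3 * ζx / 12) := by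
    rw [abs_mul, abs_neg, abs_of_nonneg (by linarith : (0 : ℝ) ≤ (y1 - y0) / 2)]
    exact mul_le_mul_of_nonneg_left ((abs_add_le _ _).trans (add_le_add hB0 hB1)) (by linarith)
  calc |-((y1 - y0) / 2) * (e0 + e1) - E| ≤ |-((y1 - y0) / 2) * (e0 + e1)| + |E| := abs_sub _ _
    _ ≤ (y1 - y0) / 2 * ((x1 - x0) ^ 3 * ζx / 12 + (x1 - x0) ^ 3 * ζx / 12) + (y1 - y0) ^ 3 * ζy / 12 * (x1 - x0) :=
        add_le_add h1 hE
    _ = (x1 - x0) * (y1 - y0) * ((y1 - y0) ^ 2 * ζy + (x1 - x0) ^ 2 * ζx) / 12 := by ring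

end Summit.HubbardSuperconductivity.HubbardSuperconductivity.Theorems.KlLindhardEnclosure

end
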